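import Summits.NavierStokesRegularity.NavierStokesRegularity.Theorems.ExtremiserTransienceTwoThirdsRemainderCurlFree
import Summits.NavierStokesRegularity.NavierStokesRegularity.Theorems.ExtremiserTransienceTwoThirdsLayerComparison
import Summits.NavierStokesRegularity.NavierStokesRegularity.Theorems.ExtremiserTransienceLocalMaximiserEulerLagrange
import Literature.Analysis.FluidPDE.TaoEnstrophyLocalisation
import HarnessLib

/-!
# Route `ExtremiserTransience`, crux `NearExtremalTransiencePerFlow` (stmt-NavierStokesRegularity-26567), LINE g10-1 «two_thirds»
# (ns-idea-10 g10), stub S2 `FirstOrderIdentity`: the LAYER JUNK, pointwise structure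

Helper file for S2 (`--supports stmt-NavierStokesRegularity-26567`).  The reduction identity (`three_Jg_sub_two_Kg_eq`) leaves the layer
integral `∫_{Pᶜ} (f₁(φ₀) + χ²(3·sd − κ⋆(zd + wd)))` with `φ₀ = χ·curl ψ − χV − curl(χψ) = −χV − curlCLM(Dχ ⊗ ψ)`.  The light-layer
hypothesis of S2 makes the layer enstrophy/palinstrophy `η`-small, so NO CANCELLATION between `f₁(φ₀)` and the `χ²` term is needed;
what IS needed is the structure «`curl φ₀ = −χω + (terms carrying ∇χ)`», so that every term of `f₁(φ₀)` is either quadratic in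
`(ω, ∇ω)` (paid by the light layer) or a product of `ω`/`∇ω` with a factor that is small in `L²` of the layer.  This file proves:

* `abs_f1_le_of_struct` — for ANY direction `φ` and number `χ₀ ∈ [0,1]`:
  `|f₁(φ)(x)| ≤ 2A₁·zd + (2A₁+κ⋆)‖β‖‖ω‖ + ‖Dφ‖·zd + κ⋆(zd + wd) + 3κ⋆‖γ‖√wd`,
  `β := curl φ(x) + χ₀ω(x)`, `γ := D(curl φ)(x) + χ₀Dω(x)` (pure algebra at the point `x`);
* `phi0_eq`, `curl_phi0_add_eq`, `fderiv_curl_phi0_add_eq`, `norm_fderiv_phi0_le`, `norm_beta_phi0_le`, `norm_gamma_phi0_le` —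
  the offsets of `φ₀` in terms of `Dχ, D²χ, D³χ`, `V, DV`, `ψ, Dψ, D²ψ` (rank-one curl calculus of `…TwoThirdsRemainderCurlFree`);
* `abs_layerIntegrand_le` — the resulting pointwise bound for `|f₁(φ₀) + χ²(3·sd − κ⋆(zd+wd))|` at a point where
  `‖Dʲχ‖ ≤ kⱼ` (`j = 1,2,3`), `0 ≤ χ ≤ 1`, `‖V‖ ≤ 1`, `‖DV‖ ≤ A₁`.

HONEST FRAMING: calculus bookkeeping; nothing about Navier–Stokes regularity or blow-up is proved; S2, the crux ⟨26567⟩ and NS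
regularity are OPEN; no summit is proved by a line. [folklore]
-/

noncomputable section

open scoped Topology InnerProductSpace RealInnerProductSpace ENNReal ContDiff
open MeasureTheory Filter Set Metric
open Literature.Analysis.FluidPDE
open Summit.NavierStokesRegularity.NavierStokesRegularity.Theorems.DepletionLadder.KStar.HalfSpace
open Summit.NavierStokesRegularity.NavierStokesRegularity.Theorems.DepletionLadder
open Summit.NavierStokesRegularity.NavierStokesRegularity.Theorems.NearExtremalTransiencePerFlow.LocalMaximiser

namespace Summit.NavierStokesRegularity.NavierStokesRegularity.Theorems.NearExtremalTransiencePerFlow.TwoThirds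

-- the summit's namespace repeats the problem name by convention (D-0017)
set_option linter.dupNamespace false

variable {V ψ φ : E3 → E3} {χ : E3 → ℝ}

/-! ## The pointwise structure lemma -/

/-- `wd = Σᵢ ‖Dω eᵢ‖²` over the standard basis. [folklore] -/
theorem wd_eq_sum_basisFun (V : E3 → E3) (x : E3) :
    wd V x = ∑ i, ‖fderiv ℝ (curl V) x (EuclideanSpace.basisFun (Fin 3) ℝ i)‖ ^ 2 := by
  unfold wd
  exact frobeniusNormSq_eq_sum (EuclideanSpace.basisFun (Fin 3) ℝ) _

/-- **STRUCTURE LEMMA.**  For any direction `φ`, any `χ₀ ∈ [0,1]` and `‖DV(x)‖ ≤ A₁`, with `β := curl φ(x) + χ₀·ω(x)` and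
`γ := D(curl φ)(x) + χ₀·Dω(x)`:
`|f₁(φ)(x)| ≤ 2A₁·zd + (2A₁+κ⋆)‖β‖‖ω‖ + ‖Dφ(x)‖·zd + κ⋆(zd + wd) + 3κ⋆‖γ‖√wd` (all densities of `V` at `x`). [folklore] -/
theorem abs_f1_le_of_struct (φ : E3 → E3) {x : E3} {A₁ χ₀ : ℝ} (hχ₀ : 0 ≤ χ₀) (hχ₁ : χ₀ ≤ 1)
    (hA : ‖fderiv ℝ V x‖ ≤ A₁) :
    |f1 V φ x| ≤ 2 * A₁ * zd V x + (2 * A₁ + kStar) * ‖curl φ x + χ₀ • curl V x‖ * ‖curl V x‖ +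
      ‖fderiv ℝ φ x‖ * zd V x + kStar * (zd V x + wd V x) +
      3 * kStar * ‖fderiv ℝ (curl φ) x + χ₀ • fderiv ℝ (curl V) x‖ * Real.sqrt (wd V x) := by
  have hK : 0 < kStar := kStar_pos
  have hA0 : 0 ≤ A₁ := (norm_nonneg _).trans hA
  set w₀ := curl V x with hw₀
  set β := curl φ x + χ₀ • w₀ with hβ
  set γ := fderiv ℝ (curl φ) x + χ₀ • fderiv ℝ (curl V) x with hγ
  have hcurl : curl φ x = β - χ₀ • w₀ := by rw [hβ]; abel
  have hDcurl : fderiv ℝ (curl φ) x = γ - χ₀ • fderiv ℝ (curl V) x := by rw [hγ]; abel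
  have hzd : zd V x = ‖w₀‖ ^ 2 := rfl
  have hsd : |sd V x| ≤ A₁ * zd V x := (abs_sd_le V x).trans (mul_le_mul_of_nonneg_right hA (by rw [hzd]; positivity))
  have hzd0 : 0 ≤ zd V x := by rw [hzd]; positivity
  have hwd0 : 0 ≤ wd V x := frobeniusNormSq_nonneg _
  have hDw₀ : ‖fderiv ℝ (curl V) x‖ ≤ Real.sqrt (wd V x) := norm_fderiv_curl_le_sqrt_wd V x
  -- `c₁`
  have h1 : |c1 V φ x| ≤ 2 * A₁ * ‖β‖ * ‖w₀‖ + 2 * χ₀ * (A₁ * zd V x) + ‖fderiv ℝ φ x‖ * zd V x := by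
    have e : c1 V φ x = ⟪β, fderiv ℝ V x w₀⟫ + ⟪w₀, fderiv ℝ φ x w₀⟫ + ⟪w₀, fderiv ℝ V x β⟫ - 2 * χ₀ * sd V x := by
      unfold c1 sd
      rw [← hw₀, hcurl, inner_sub_left, map_sub, map_smul, inner_sub_right, real_inner_smul_left, real_inner_smul_right]
      ring
    rw [e]
    have t1 : |⟪β, fderiv ℝ V x w₀⟫| ≤ ‖β‖ * (A₁ * ‖w₀‖) := (abs_real_inner_le_norm _ _).trans
      (mul_le_mul_of_nonneg_left ((ContinuousLinearMap.le_opNorm _ _).trans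
        (mul_le_mul_of_nonneg_right hA (norm_nonneg _))) (norm_nonneg _))
    have t2 : |⟪w₀, fderiv ℝ φ x w₀⟫| ≤ ‖w₀‖ * (‖fderiv ℝ φ x‖ * ‖w₀‖) :=
      (abs_real_inner_le_norm _ _).trans (mul_le_mul_of_nonneg_left (ContinuousLinearMap.le_opNorm _ _) (norm_nonneg _))
    have t3 : |⟪w₀, fderiv ℝ V x β⟫| ≤ ‖w₀‖ * (A₁ * ‖β‖) := (abs_real_inner_le_norm _ _).trans
      (mul_le_mul_of_nonneg_left ((ContinuousLinearMap.le_opNorm _ _).trans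
        (mul_le_mul_of_nonneg_right hA (norm_nonneg _))) (norm_nonneg _))
    have t4 : |2 * χ₀ * sd V x| ≤ 2 * χ₀ * (A₁ * zd V x) := by
      rw [abs_mul, abs_of_nonneg (by positivity : (0 : ℝ) ≤ 2 * χ₀)]
      exact mul_le_mul_of_nonneg_left hsd (by positivity)
    calc |⟪β, fderiv ℝ V x w₀⟫ + ⟪w₀, fderiv ℝ φ x w₀⟫ + ⟪w₀, fderiv ℝ V x β⟫ - 2 * χ₀ * sd V x|
        ≤ |⟪β, fderiv ℝ V x w₀⟫| + |⟪w₀, fderiv ℝ φ x w₀⟫| + |⟪w₀, fderiv ℝ V x β⟫| + |2 * χ₀ * sd V x| := by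
          have := abs_add_three ⟪β, fderiv ℝ V x w₀⟫ ⟪w₀, fderiv ℝ φ x w₀⟫ ⟪w₀, fderiv ℝ V x β⟫
          have := abs_sub (⟪β, fderiv ℝ V x w₀⟫ + ⟪w₀, fderiv ℝ φ x w₀⟫ + ⟪w₀, fderiv ℝ V x β⟫) (2 * χ₀ * sd V x)
          linarith
      _ ≤ ‖β‖ * (A₁ * ‖w₀‖) + ‖w₀‖ * (‖fderiv ℝ φ x‖ * ‖w₀‖) + ‖w₀‖ * (A₁ * ‖β‖) + 2 * χ₀ * (A₁ * zd V x) := by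
          gcongr
      _ = 2 * A₁ * ‖β‖ * ‖w₀‖ + 2 * χ₀ * (A₁ * zd V x) + ‖fderiv ℝ φ x‖ * zd V x := by rw [hzd]; ring
  -- `z₁`
  have h2 : |z1 V φ x| ≤ ‖w₀‖ * ‖β‖ + χ₀ * zd V x := by
    have e : z1 V φ x = ⟪w₀, β⟫ - χ₀ * zd V x := by
      unfold z1
      rw [← hw₀, hcurl, inner_sub_right, real_inner_smul_right, hzd, ← real_inner_self_eq_norm_sq]
    rw [e]
    calc |⟪w₀, β⟫ - χ₀ * zd V x| ≤ |⟪w₀, β⟫| + |χ₀ * zd V x| := abs_sub _ _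
      _ ≤ ‖w₀‖ * ‖β‖ + χ₀ * zd V x := by
          gcongr
          · exact abs_real_inner_le_norm _ _
          · rw [abs_of_nonneg (by positivity)]
  -- `w₁`
  have h3 : |w1 V φ x| ≤ 3 * ‖γ‖ * Real.sqrt (wd V x) + χ₀ * wd V x := by
    set e := EuclideanSpace.basisFun (Fin 3) ℝ with he
    have hterm : ∀ i : Fin 3, ⟪fderiv ℝ (curl V) x (e i), fderiv ℝ (curl φ) x (e i)⟫ =
        ⟪fderiv ℝ (curl V) x (e i), γ (e i)⟫ - χ₀ * ‖fderiv ℝ (curl V) x (e i)‖ ^ 2 := by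
      intro i
      rw [hDcurl, show (γ - χ₀ • fderiv ℝ (curl V) x) (e i) = γ (e i) - χ₀ • fderiv ℝ (curl V) x (e i) from rfl, inner_sub_right, real_inner_smul_right,
        real_inner_self_eq_norm_sq]
    have hsum : w1 V φ x = (∑ i, ⟪fderiv ℝ (curl V) x (e i), γ (e i)⟫) - χ₀ * wd V x := by
      unfold w1
      rw [← he]
      simp_rw [hterm]
      rw [Finset.sum_sub_distrib, ← Finset.mul_sum, ← wd_eq_sum_basisFun]
    rw [hsum]
    have hei : ∀ i : Fin 3, ‖e i‖ = 1 := fun i => by simp [he, EuclideanSpace.basisFun_apply]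
    have hb : ∀ i : Fin 3, |⟪fderiv ℝ (curl V) x (e i), γ (e i)⟫| ≤ Real.sqrt (wd V x) * ‖γ‖ := by
      intro i
      calc |⟪fderiv ℝ (curl V) x (e i), γ (e i)⟫| ≤ ‖fderiv ℝ (curl V) x (e i)‖ * ‖γ (e i)‖ := abs_real_inner_le_norm _ _
        _ ≤ (‖fderiv ℝ (curl V) x‖ * ‖e i‖) * (‖γ‖ * ‖e i‖) :=
            mul_le_mul (ContinuousLinearMap.le_opNorm _ _) (ContinuousLinearMap.le_opNorm _ _) (norm_nonneg _)
              (by positivity)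
        _ ≤ Real.sqrt (wd V x) * ‖γ‖ := by
            rw [hei i, mul_one, mul_one]
            exact mul_le_mul_of_nonneg_right hDw₀ (norm_nonneg _)
    calc |(∑ i, ⟪fderiv ℝ (curl V) x (e i), γ (e i)⟫) - χ₀ * wd V x|
        ≤ |∑ i, ⟪fderiv ℝ (curl V) x (e i), γ (e i)⟫| + |χ₀ * wd V x| := abs_sub _ _
      _ ≤ (∑ i : Fin 3, Real.sqrt (wd V x) * ‖γ‖) + χ₀ * wd V x := by
          gcongr
          · exact (Finset.abs_sum_le_sum_abs _ _).trans (Finset.sum_le_sum fun i _ => hb i)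
          · rw [abs_of_nonneg (by positivity)]
      _ = 3 * ‖γ‖ * Real.sqrt (wd V x) + χ₀ * wd V x := by
          rw [Finset.sum_const, Finset.card_univ, Fintype.card_fin, nsmul_eq_mul]
          push_cast
          ring
  -- combine
  have e : f1 V φ x = c1 V φ x - kStar * z1 V φ x - kStar * w1 V φ x := by
    unfold f1; ring
  rw [e]
  have hχzd : 2 * χ₀ * (A₁ * zd V x) ≤ 2 * A₁ * zd V x := by nlinarith [mul_nonneg hA0 hzd0]
  have hχzd' : kStar * (χ₀ * zd V x) ≤ kStar * zd V x := by nlinarith [mul_nonneg hK.le hzd0]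
  have hχwd : kStar * (χ₀ * wd V x) ≤ kStar * wd V x := by nlinarith [mul_nonneg hK.le hwd0]
  calc |c1 V φ x - kStar * z1 V φ x - kStar * w1 V φ x|
      ≤ |c1 V φ x| + |kStar * z1 V φ x| + |kStar * w1 V φ x| := by
        have := abs_sub (c1 V φ x - kStar * z1 V φ x) (kStar * w1 V φ x)
        have := abs_sub (c1 V φ x) (kStar * z1 V φ x)
        linarith
    _ ≤ (2 * A₁ * ‖β‖ * ‖w₀‖ + 2 * χ₀ * (A₁ * zd V x) + ‖fderiv ℝ φ x‖ * zd V x) +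
        kStar * (‖w₀‖ * ‖β‖ + χ₀ * zd V x) + kStar * (3 * ‖γ‖ * Real.sqrt (wd V x) + χ₀ * wd V x) := by
        rw [abs_mul, abs_mul, abs_of_pos hK]
        gcongr
    _ ≤ 2 * A₁ * zd V x + (2 * A₁ + kStar) * ‖β‖ * ‖w₀‖ + ‖fderiv ℝ φ x‖ * zd V x + kStar * (zd V x + wd V x) +
        3 * kStar * ‖γ‖ * Real.sqrt (wd V x) := by nlinarith [hχzd, hχzd', hχwd]

/-! ## The offsets of `φ₀ = χ·curl ψ − χV − curl(χψ)` -/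

/-- `φ₀ = −χV − curlCLM(Dχ ⊗ ψ)`. [folklore] -/
theorem phi0_eq (hχ : ContDiff ℝ (⊤ : ℕ∞) χ) (hψ : ContDiff ℝ (⊤ : ℕ∞) ψ) :
    (fun y => χ y • curl ψ y - χ y • V y - curl (fun z => χ z • ψ z) y) =
      fun y => -(χ y • V y) - curlCLM ((fderiv ℝ χ y).smulRight (ψ y)) := by
  have hχd : Differentiable ℝ χ := hχ.differentiable (by simp)
  have hψd : Differentiable ℝ ψ := hψ.differentiable (by simp)
  funext y
  rw [curl_smul (hχd y) (hψd y)]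
  abel

/-- `curl φ₀ + χω = −curlCLM(Dχ ⊗ V) − curl(curlCLM(Dχ ⊗ ψ))`. [folklore] -/
theorem curl_phi0_add_eq (hV : ContDiff ℝ (⊤ : ℕ∞) V) (hχ : ContDiff ℝ (⊤ : ℕ∞) χ) (hψ : ContDiff ℝ (⊤ : ℕ∞) ψ) (x : E3) :
    curl (fun y => χ y • curl ψ y - χ y • V y - curl (fun z => χ z • ψ z) y) x + χ x • curl V x =
      -(curlCLM ((fderiv ℝ χ x).smulRight (V x))) - curl (fun y => curlCLM ((fderiv ℝ χ y).smulRight (ψ y))) x := by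
  have hχd : Differentiable ℝ χ := hχ.differentiable (by simp)
  have hVd : Differentiable ℝ V := hV.differentiable (by simp)
  have hΞd : Differentiable ℝ fun y => curlCLM ((fderiv ℝ χ y).smulRight (ψ y)) :=
    (contDiff_rankOneCurl hχ hψ).differentiable (by simp)
  have hχVd : DifferentiableAt ℝ (fun y => -(χ y • V y)) x := ((hχd x).smul (hVd x)).neg
  rw [phi0_eq hχ hψ, curl_sub hχVd (hΞd x), curl_neg, curl_smul (hχd x) (hVd x)]
  abel

/-- `curl φ₀` as a function. [folklore] -/
theorem curl_phi0_eq (hV : ContDiff ℝ (⊤ : ℕ∞) V) (hχ : ContDiff ℝ (⊤ : ℕ∞) χ) (hψ : ContDiff ℝ (⊤ : ℕ∞) ψ) :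
    curl (fun y => χ y • curl ψ y - χ y • V y - curl (fun z => χ z • ψ z) y) =
      fun x => -(χ x • curl V x) - curlCLM ((fderiv ℝ χ x).smulRight (V x)) -
        curl (fun y => curlCLM ((fderiv ℝ χ y).smulRight (ψ y))) x := by
  funext x
  have h := curl_phi0_add_eq hV hχ hψ x
  have e : curl (fun y => χ y • curl ψ y - χ y • V y - curl (fun z => χ z • ψ z) y) x =
      (curl (fun y => χ y • curl ψ y - χ y • V y - curl (fun z => χ z • ψ z) y) x + χ x • curl V x) - χ x • curl V x := by
    abel
  rw [e, h]
  abel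

/-- `D(curl φ₀) + χDω = −(Dχ ⊗ ω) − D(curlCLM(Dχ ⊗ V)) − D(curl(curlCLM(Dχ ⊗ ψ)))`. [folklore] -/
theorem fderiv_curl_phi0_add_eq (hV : ContDiff ℝ (⊤ : ℕ∞) V) (hχ : ContDiff ℝ (⊤ : ℕ∞) χ) (hψ : ContDiff ℝ (⊤ : ℕ∞) ψ) (x : E3) :
    fderiv ℝ (curl (fun y => χ y • curl ψ y - χ y • V y - curl (fun z => χ z • ψ z) y)) x + χ x • fderiv ℝ (curl V) x =
      -((fderiv ℝ χ x).smulRight (curl V x)) - fderiv ℝ (fun y => curlCLM ((fderiv ℝ χ y).smulRight (V y))) x -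
        fderiv ℝ (curl fun y => curlCLM ((fderiv ℝ χ y).smulRight (ψ y))) x := by
  have hχd : Differentiable ℝ χ := hχ.differentiable (by simp)
  have hω : ContDiff ℝ (⊤ : ℕ∞) (curl V) := contDiff_curl (n := ⊤) hV
  have hωd : Differentiable ℝ (curl V) := hω.differentiable (by simp)
  have hΞV : Differentiable ℝ fun y => curlCLM ((fderiv ℝ χ y).smulRight (V y)) :=
    (contDiff_rankOneCurl hχ hV).differentiable (by simp)
  have hcΞψ : Differentiable ℝ (curl fun y => curlCLM ((fderiv ℝ χ y).smulRight (ψ y))) :=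
    (contDiff_curl (n := ⊤) (contDiff_rankOneCurl hχ hψ)).differentiable (by simp)
  rw [curl_phi0_eq hV hχ hψ]
  have h1 : DifferentiableAt ℝ (fun y => -(χ y • curl V y)) x := ((hχd x).smul (hωd x)).neg
  have h2 : DifferentiableAt ℝ (fun y => -(χ y • curl V y) - curlCLM ((fderiv ℝ χ y).smulRight (V y))) x := h1.sub (hΞV x)
  rw [fderiv_fun_sub h2 (hcΞψ x), fderiv_fun_sub h1 (hΞV x), fderiv_fun_neg, fderiv_fun_smul (hχd x) (hωd x)]
  abel

/-- `‖Dφ₀(x)‖ ≤ |χ|‖DV‖ + ‖Dχ‖‖V‖ + c(‖D²χ‖‖ψ‖ + ‖Dχ‖‖Dψ‖)`. [folklore] -/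
theorem norm_fderiv_phi0_le (hV : ContDiff ℝ (⊤ : ℕ∞) V) (hχ : ContDiff ℝ (⊤ : ℕ∞) χ) (hψ : ContDiff ℝ (⊤ : ℕ∞) ψ) (x : E3) :
    ‖fderiv ℝ (fun y => χ y • curl ψ y - χ y • V y - curl (fun z => χ z • ψ z) y) x‖ ≤
      |χ x| * ‖fderiv ℝ V x‖ + ‖fderiv ℝ χ x‖ * ‖V x‖ +
        ‖curlCLM‖ * (‖iteratedFDeriv ℝ 2 χ x‖ * ‖ψ x‖ + ‖fderiv ℝ χ x‖ * ‖fderiv ℝ ψ x‖) := by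
  have hχd : Differentiable ℝ χ := hχ.differentiable (by simp)
  have hVd : Differentiable ℝ V := hV.differentiable (by simp)
  have hΞd : Differentiable ℝ fun y => curlCLM ((fderiv ℝ χ y).smulRight (ψ y)) :=
    (contDiff_rankOneCurl hχ hψ).differentiable (by simp)
  have h1 : DifferentiableAt ℝ (fun y => -(χ y • V y)) x := ((hχd x).smul (hVd x)).neg
  rw [phi0_eq hχ hψ, fderiv_fun_sub h1 (hΞd x), fderiv_fun_neg]
  calc ‖-fderiv ℝ (fun y => χ y • V y) x - fderiv ℝ (fun y => curlCLM ((fderiv ℝ χ y).smulRight (ψ y))) x‖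
      ≤ ‖-fderiv ℝ (fun y => χ y • V y) x‖ + ‖fderiv ℝ (fun y => curlCLM ((fderiv ℝ χ y).smulRight (ψ y))) x‖ :=
        norm_sub_le _ _
    _ ≤ (|χ x| * ‖fderiv ℝ V x‖ + ‖fderiv ℝ χ x‖ * ‖V x‖) +
        ‖curlCLM‖ * (‖iteratedFDeriv ℝ 2 χ x‖ * ‖ψ x‖ + ‖fderiv ℝ χ x‖ * ‖fderiv ℝ ψ x‖) := by
        rw [norm_neg]
        exact add_le_add (norm_fderiv_smul_le hχ hV x) (norm_fderiv_rankOneCurl_le hχ hψ x)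

/-- `‖β‖ = ‖curl φ₀ + χω‖ ≤ c‖Dχ‖‖V‖ + c²(‖D²χ‖‖ψ‖ + ‖Dχ‖‖Dψ‖)`. [folklore] -/
theorem norm_beta_phi0_le (hV : ContDiff ℝ (⊤ : ℕ∞) V) (hχ : ContDiff ℝ (⊤ : ℕ∞) χ) (hψ : ContDiff ℝ (⊤ : ℕ∞) ψ) (x : E3) :
    ‖curl (fun y => χ y • curl ψ y - χ y • V y - curl (fun z => χ z • ψ z) y) x + χ x • curl V x‖ ≤
      ‖curlCLM‖ * ‖fderiv ℝ χ x‖ * ‖V x‖ +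
        ‖curlCLM‖ * (‖curlCLM‖ * (‖iteratedFDeriv ℝ 2 χ x‖ * ‖ψ x‖ + ‖fderiv ℝ χ x‖ * ‖fderiv ℝ ψ x‖)) := by
  rw [curl_phi0_add_eq hV hχ hψ x]
  calc ‖-(curlCLM ((fderiv ℝ χ x).smulRight (V x))) - curl (fun y => curlCLM ((fderiv ℝ χ y).smulRight (ψ y))) x‖
      ≤ ‖-(curlCLM ((fderiv ℝ χ x).smulRight (V x)))‖ + ‖curl (fun y => curlCLM ((fderiv ℝ χ y).smulRight (ψ y))) x‖ :=
        norm_sub_le _ _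
    _ ≤ ‖curlCLM‖ * ‖fderiv ℝ χ x‖ * ‖V x‖ +
        ‖curlCLM‖ * (‖curlCLM‖ * (‖iteratedFDeriv ℝ 2 χ x‖ * ‖ψ x‖ + ‖fderiv ℝ χ x‖ * ‖fderiv ℝ ψ x‖)) := by
        rw [norm_neg]
        refine add_le_add (norm_rankOneCurl_le χ V x) ?_
        exact (norm_curl_le _ x).trans (mul_le_mul_of_nonneg_left (norm_fderiv_rankOneCurl_le hχ hψ x) (norm_nonneg curlCLM))

/-- `‖γ‖ = ‖D(curl φ₀) + χDω‖ ≤ ‖Dχ‖‖ω‖ + c(‖D²χ‖‖V‖ + ‖Dχ‖‖DV‖) + c²(‖D³χ‖‖ψ‖ + 2‖D²χ‖‖Dψ‖ + ‖Dχ‖‖D²ψ‖)`. [folklore] -/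
theorem norm_gamma_phi0_le (hV : ContDiff ℝ (⊤ : ℕ∞) V) (hχ : ContDiff ℝ (⊤ : ℕ∞) χ) (hψ : ContDiff ℝ (⊤ : ℕ∞) ψ) (x : E3) :
    ‖fderiv ℝ (curl (fun y => χ y • curl ψ y - χ y • V y - curl (fun z => χ z • ψ z) y)) x + χ x • fderiv ℝ (curl V) x‖ ≤
      ‖fderiv ℝ χ x‖ * ‖curl V x‖ +
        ‖curlCLM‖ * (‖iteratedFDeriv ℝ 2 χ x‖ * ‖V x‖ + ‖fderiv ℝ χ x‖ * ‖fderiv ℝ V x‖) +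
        ‖curlCLM‖ * (‖curlCLM‖ * (‖iteratedFDeriv ℝ 3 χ x‖ * ‖ψ x‖ + 2 * ‖iteratedFDeriv ℝ 2 χ x‖ * ‖fderiv ℝ ψ x‖ +
          ‖fderiv ℝ χ x‖ * ‖iteratedFDeriv ℝ 2 ψ x‖)) := by
  have hΞψ : ContDiff ℝ (⊤ : ℕ∞) fun y => curlCLM ((fderiv ℝ χ y).smulRight (ψ y)) := contDiff_rankOneCurl hχ hψ
  rw [fderiv_curl_phi0_add_eq hV hχ hψ x]
  calc ‖-((fderiv ℝ χ x).smulRight (curl V x)) - fderiv ℝ (fun y => curlCLM ((fderiv ℝ χ y).smulRight (V y))) x -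
        fderiv ℝ (curl fun y => curlCLM ((fderiv ℝ χ y).smulRight (ψ y))) x‖
      ≤ ‖-((fderiv ℝ χ x).smulRight (curl V x))‖ + ‖fderiv ℝ (fun y => curlCLM ((fderiv ℝ χ y).smulRight (V y))) x‖ +
        ‖fderiv ℝ (curl fun y => curlCLM ((fderiv ℝ χ y).smulRight (ψ y))) x‖ :=
        (norm_sub_le _ _).trans (add_le_add (norm_sub_le _ _) le_rfl)
    _ ≤ _ := by
        rw [norm_neg, ContinuousLinearMap.norm_smulRight_apply]
        refine add_le_add (add_le_add le_rfl (norm_fderiv_rankOneCurl_le hχ hV x)) ?_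
        exact (norm_fderiv_curl_le hΞψ x).trans
          (mul_le_mul_of_nonneg_left (norm_iteratedFDeriv_two_rankOneCurl_le hχ hψ x) (norm_nonneg curlCLM))

end Summit.NavierStokesRegularity.NavierStokesRegularity.Theorems.NearExtremalTransiencePerFlow.TwoThirds

end
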